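import Literature.AlgebraicGeometry.Modules.ModuleCechComplex
import Literature.Algebra.Homology.OrderedCechSystemCupAlgebra
import HarnessLib

/-!
# The multiplication pairing of the structure sheaf on the module Čech system (the cup-product datum of `𝒪_X`)

For a scheme `X`, a ring homomorphism `ρ : A → Γ(X, 𝒪_X)` and a family of opens `𝓥 = (V_i)_{i ∈ ι}`, the system
of `A`-modules `s ↦ Γ(𝒪_X, V_s)` (★ `Modules.sectionsSystem 𝓥 (unitModule X) ρ`) carries the MULTIPLICATION of
sections as an `A`-bilinear pairing `mulPairing 𝓥 ρ s : Γ(V_s) × Γ(V_s) → Γ(V_s)`.  It is natural in `s`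
(restrictions are ring maps: `isNaturalPairing_mulPairing`, the hypothesis of the ordered Čech cup product ★
`OrderedCech.cup` ∕ `cupH`), commutative (`mulPairing_comm`), associative (`mulPairing_assoc`, the `compat`
hypothesis of ★ `cupH_assoc` for `α = β = γ = δ = mulPairing`) and unital for the compatible family of unit
sections `1 ∈ Γ(V_s)` (`unitFamily`, `unitFamily_compatible`, `mulPairing_unitFamily_left∕right`, the hypotheses of ★
`cupH_unit_left∕right`).  This is the datum `μ` with which `Ȟ•(𝓥, 𝒪_X)` becomes a graded ring (Godement II §6.6);
nothing but bookkeeping. [cite: Godement1958, II §6.6] [cite: GortzWedhorn2023, Def. 21.68 (p. 180)]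
-/

noncomputable section

universe u

open CategoryTheory AlgebraicGeometry TopologicalSpace Opposite
open Literature.Algebra.Homology Literature.Algebra.Homology.OrderedCech

namespace Literature.AlgebraicGeometry.Modules

variable {X : Scheme.{u}} {ι : Type} (𝓥 : ι → X.Opens) {A : Type u} [CommRing A] (ρ : A →+* Γ(X, ⊤))

namespace SecMod

/-- A section of `𝒪_X` over `U`, read in the RING `Γ(X, U)` (the identification `Γ(unitModule X, U) = Γ(X, U)`).
[cite: GortzWedhorn2023, Def. 21.68 (p. 180)] -/
def toRing {U : X.Opens} (x : SecMod (unitModule X) ρ U) : Γ(X, U) := val x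

/-- A function on `U` as an element of the `A`-module `Γ(𝒪_X, U)`. [cite: GortzWedhorn2023, Def. 21.68 (p. 180)] -/
def ofRing {U : X.Opens} (f : Γ(X, U)) : SecMod (unitModule X) ρ U := mk (show Γ(unitModule X, U) from f)

/-- `toRing (ofRing f) = f`. [cite: GortzWedhorn2023, Def. 21.68 (p. 180)] -/
@[simp] theorem toRing_ofRing {U : X.Opens} (f : Γ(X, U)) : toRing ρ (ofRing ρ f) = f := rfl

/-- `ofRing (toRing x) = x`. [cite: GortzWedhorn2023, Def. 21.68 (p. 180)] -/
@[simp] theorem ofRing_toRing {U : X.Opens} (x : SecMod (unitModule X) ρ U) : ofRing ρ (toRing ρ x) = x := rfl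

/-- `toRing` is additive. [cite: GortzWedhorn2023, Def. 21.68 (p. 180)] -/
@[simp] theorem toRing_add {U : X.Opens} (x y : SecMod (unitModule X) ρ U) :
    toRing ρ (x + y) = toRing ρ x + toRing ρ y := rfl

/-- `toRing 0 = 0`. [cite: GortzWedhorn2023, Def. 21.68 (p. 180)] -/
@[simp] theorem toRing_zero {U : X.Opens} : toRing ρ (0 : SecMod (unitModule X) ρ U) = 0 := rfl

/-- The `A`-action through `ρ` is multiplication by `ρ(a)|_U`: `toRing (a • x) = ρ(a)|_U * toRing x`.
[cite: GortzWedhorn2023, Def. 21.68 (p. 180)] -/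
theorem toRing_smul {U : X.Opens} (a : A) (x : SecMod (unitModule X) ρ U) :
    toRing ρ (a • x) = toSections ρ U a * toRing ρ x := rfl

/-- `toRing` is injective. [cite: GortzWedhorn2023, Def. 21.68 (p. 180)] -/
theorem toRing_injective {U : X.Opens} : Function.Injective (toRing ρ : SecMod (unitModule X) ρ U → Γ(X, U)) :=
  fun _ _ h => h

/-- Restriction of `𝒪_X`-sections is the ring restriction: `toRing (res h x) = (toRing x)|_W`.
[cite: GortzWedhorn2023, Def. 21.68 (p. 180)] -/
theorem toRing_res {U W : X.Opens} (h : W ≤ U) (x : SecMod (unitModule X) ρ U) :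
    toRing ρ (res (unitModule X) ρ h x) = X.presheaf.map (homOfLE h).op (toRing ρ x) := rfl

end SecMod

/-- **The multiplication pairing `Γ(𝒪, V_s) × Γ(𝒪, V_s) → Γ(𝒪, V_s)`** on the module Čech system of `𝒪_X`, as an
`A`-bilinear map. [cite: Godement1958, II §6.6] -/
def mulPairing (s : Finset ι) :
    (sectionsSystem 𝓥 (unitModule X) ρ).obj s →ₗ[A] (sectionsSystem 𝓥 (unitModule X) ρ).obj s →ₗ[A]
      (sectionsSystem 𝓥 (unitModule X) ρ).obj s :=
  LinearMap.mk₂ A (fun x y => SecMod.ofRing ρ (SecMod.toRing ρ x * SecMod.toRing ρ y))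
    (fun x x' y => SecMod.toRing_injective ρ (by
      show (SecMod.toRing ρ x + SecMod.toRing ρ x') * SecMod.toRing ρ y =
        SecMod.toRing ρ x * SecMod.toRing ρ y + SecMod.toRing ρ x' * SecMod.toRing ρ y
      exact add_mul _ _ _))
    (fun a x y => SecMod.toRing_injective ρ (by
      show (toSections ρ _ a * SecMod.toRing ρ x) * SecMod.toRing ρ y =
        toSections ρ _ a * (SecMod.toRing ρ x * SecMod.toRing ρ y)
      exact mul_assoc _ _ _))
    (fun x y y' => SecMod.toRing_injective ρ (by
      show SecMod.toRing ρ x * (SecMod.toRing ρ y + SecMod.toRing ρ y') =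
        SecMod.toRing ρ x * SecMod.toRing ρ y + SecMod.toRing ρ x * SecMod.toRing ρ y'
      exact mul_add _ _ _))
    (fun a x y => SecMod.toRing_injective ρ (by
      show SecMod.toRing ρ x * (toSections ρ _ a * SecMod.toRing ρ y) =
        toSections ρ _ a * (SecMod.toRing ρ x * SecMod.toRing ρ y)
      exact mul_left_comm _ _ _))

/-- The pairing on underlying functions: `toRing (μ x y) = toRing x * toRing y`. [cite: Godement1958, II §6.6] -/
@[simp] theorem toRing_mulPairing (s : Finset ι) (x y : (sectionsSystem 𝓥 (unitModule X) ρ).obj s) :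
    SecMod.toRing ρ (mulPairing 𝓥 ρ s x y) = SecMod.toRing ρ x * SecMod.toRing ρ y := rfl

/-- **Naturality**: restriction is multiplicative, so `mulPairing` is a natural pairing of systems (the hypothesis
`IsNaturalPairing` of the ordered Čech cup product). [cite: Godement1958, II §6.6] -/
theorem isNaturalPairing_mulPairing : IsNaturalPairing (mulPairing 𝓥 ρ) := by
  intro s t h x y
  apply SecMod.toRing_injective ρ
  rw [sectionsSystem_map_apply, sectionsSystem_map_apply, sectionsSystem_map_apply, SecMod.toRing_res,
    toRing_mulPairing, toRing_mulPairing, SecMod.toRing_res, SecMod.toRing_res, map_mul]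

/-- **Commutativity** of the multiplication pairing. [cite: Godement1958, II §6.6] -/
theorem mulPairing_comm (s : Finset ι) (x y : (sectionsSystem 𝓥 (unitModule X) ρ).obj s) :
    mulPairing 𝓥 ρ s x y = mulPairing 𝓥 ρ s y x := by
  apply SecMod.toRing_injective ρ
  rw [toRing_mulPairing, toRing_mulPairing, mul_comm]

/-- **Associativity** of the multiplication pairing (the `compat` hypothesis of `cupH_assoc` with all four pairings
equal to `mulPairing`). [cite: Godement1958, II §6.6] -/
theorem mulPairing_assoc (s : Finset ι) (x y z : (sectionsSystem 𝓥 (unitModule X) ρ).obj s) :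
    mulPairing 𝓥 ρ s (mulPairing 𝓥 ρ s x y) z = mulPairing 𝓥 ρ s x (mulPairing 𝓥 ρ s y z) := by
  apply SecMod.toRing_injective ρ
  rw [toRing_mulPairing, toRing_mulPairing, toRing_mulPairing, toRing_mulPairing, mul_assoc]

/-- **The unit sections** `1 ∈ Γ(𝒪, V_s)`. [cite: Godement1958, II §6.6] -/
def unitFamily (s : Finset ι) : (sectionsSystem 𝓥 (unitModule X) ρ).obj s := SecMod.ofRing ρ 1

/-- `toRing (unitFamily s) = 1`. [cite: Godement1958, II §6.6] -/
@[simp] theorem toRing_unitFamily (s : Finset ι) : SecMod.toRing ρ (unitFamily 𝓥 ρ s) = 1 := rfl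

/-- The unit sections are compatible with restriction (the hypothesis `hu` of ★ `unit_cup`∕`cupH_unit_left`).
[cite: Godement1958, II §6.6] -/
theorem unitFamily_compatible ⦃s t : Finset ι⦄ (h : s ⊆ t) :
    ((sectionsSystem 𝓥 (unitModule X) ρ).map (homOfLE h)).hom (unitFamily 𝓥 ρ s) = unitFamily 𝓥 ρ t := by
  apply SecMod.toRing_injective ρ
  rw [sectionsSystem_map_apply, SecMod.toRing_res, toRing_unitFamily, toRing_unitFamily, map_one]

/-- Left unit: `μ(1, y) = y`. [cite: Godement1958, II §6.6] -/
@[simp] theorem mulPairing_unitFamily_left (s : Finset ι) (y : (sectionsSystem 𝓥 (unitModule X) ρ).obj s) :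
    mulPairing 𝓥 ρ s (unitFamily 𝓥 ρ s) y = y := by
  apply SecMod.toRing_injective ρ
  rw [toRing_mulPairing, toRing_unitFamily, one_mul]

/-- Right unit: `μ(y, 1) = y`. [cite: Godement1958, II §6.6] -/
@[simp] theorem mulPairing_unitFamily_right (s : Finset ι) (y : (sectionsSystem 𝓥 (unitModule X) ρ).obj s) :
    mulPairing 𝓥 ρ s y (unitFamily 𝓥 ρ s) = y := by
  apply SecMod.toRing_injective ρ
  rw [toRing_mulPairing, toRing_unitFamily, mul_one]

variable [LinearOrder ι]

/-- **The unit `0`-cochain of `Č•(𝓥, 𝒪_X)` is a cocycle.** [cite: Godement1958, II §6.6] -/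
theorem sysD_unitCochain_eq_zero :
    sysD (sectionsSystem 𝓥 (unitModule X) ρ) 0 (fun σ => unitFamily 𝓥 ρ σ.1) = 0 :=
  sysD_unit_eq_zero (M := sectionsSystem 𝓥 (unitModule X) ρ) (fun s => unitFamily 𝓥 ρ s) (unitFamily_compatible 𝓥 ρ)

end Literature.AlgebraicGeometry.Modules

end
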